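import Summits.KontsevichZagierPeriods.KontsevichZagierPeriods.Theorems.HurwitzMicroSectorsNormalFormPrincipleDlogMoves
import Summits.KontsevichZagierPeriods.KontsevichZagierPeriods.Theorems.HurwitzMicroSectorsNormalFormPrincipleSplitAlgebra

/-!
# `NormalFormPrinciple` (stmt-KontsevichZagierPeriods-3869), line `SketchIdeator1` — the dlog
# lattice: Conjecture 1 in kernel form for the dlog family over `ℚ` (siege k8: certificate on
# the finite core)

Pure proof file (`--supports` the crux stmt-KontsevichZagierPeriods-3869). It proves the
registered sub-goal `dlog_sum_mem_relations` of the leaf `stub_boxRigidity` in dimension one: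

> for dlog representations `Lᵢ = [(aᵢ, bᵢ), cᵢ/y]` (`aᵢ, bᵢ, cᵢ ∈ ℚ`, `0 < aᵢ < bᵢ`) and integers
> `nᵢ`, if `eval (Σ nᵢ • [Lᵢ]) = 0` then `Σ nᵢ • [Lᵢ] ∈ KZ.relations`.

## Proof: reduction to a finite certificate

Work in `Q = FormalRep ⧸ relations` and write `Λ(N, c)` for the class of a dlog representation
`[(1, N), c/y]`, `N ∈ ℕ` (the *carriers*). The four moves of
`Theorems/HurwitzMicroSectorsNormalFormPrincipleDlogMoves.lean` give, inside `Q`,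

* `Λ(M N, c) = Λ(M, c) + Λ(N, c)` (split `(1, MN)` at `M`, rescale `(M, MN)` by `1/M`), hence
  `Λ(N, c) = Σ_p v_p(N) • Λ(p, c)` (unique factorisation);
* `c ↦ Λ(N, c)` is additive (merging), `Λ(N, 0) = 0`;
* `[Lᵢ] = Λ(Bᵢ, cᵢ) − Λ(Aᵢ, cᵢ)` where `bᵢ/aᵢ = Bᵢ/Aᵢ` in lowest terms (rescale by `Aᵢ/aᵢ`,
  split).

So the class of `Σ nᵢ • [Lᵢ]` is `Σ_{p ∈ S} Λ(p, C_p)` with the **finite core**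
`C_p = Σᵢ nᵢ (v_p(Bᵢ) − v_p(Aᵢ)) cᵢ ∈ ℚ` over the finite set `S` of primes dividing some
`Aᵢ Bᵢ`, while the value is `Σ_{p ∈ S} C_p log p`. Vanishing of the value forces the
certificate `C = 0` (`eq_zero_of_rat_add_sum_mul_log_prime_eq_zero`: unique factorisation and
Hermite–Lindemann, `Theorems/HurwitzMicroSectorsNormalFormPrincipleSplitAlgebra.lean`), and
`Λ(p, 0) = 0`.

Sources: M. Kontsevich, D. Zagier, *Periods* (2001), §1.1 (`log 2 = ∫₁² dx/x`), §1.2 rules (1),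
(2) and Conjecture 1. No definitions are introduced: the dlog representatives are a hypothesis
`R` with its specification `hR` (discharged by `exists_dlog` in the final theorem).
-/

noncomputable section

open MeasureTheory Set Finset
open Literature.NumberTheory.Transcendental Literature.NumberTheory.Transcendental.KZ

namespace Summit.KontsevichZagierPeriods.HurwitzMicroSectors.NormalFormPrinciple.PiBox

namespace Dlog

namespace K8

/-! ## Classes modulo relations -/

/-- `x − y ∈ relations` as an identity of classes. [folklore] -/
theorem mk_eq_mk_of_sub_mem {x y : FormalRep} (h : x - y ∈ relations) :
    (x : FormalRep ⧸ relations) = y :=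
  QuotientAddGroup.eq_iff_sub_mem.mpr h

/-- `x − y − z ∈ relations` as an identity of classes. [folklore] -/
theorem mk_eq_add_of_sub_sub_mem {x y z : FormalRep} (h : x - y - z ∈ relations) :
    (x : FormalRep ⧸ relations) = y + z := by
  have h' : ((x - y - z : FormalRep) : FormalRep ⧸ relations) = 0 :=
    (QuotientAddGroup.eq_zero_iff _).mpr h
  simp only [QuotientAddGroup.mk_sub] at h'
  rw [sub_sub, sub_eq_zero] at h'
  exact h'

section Carriers

variable {R : ℚ → ℚ → ℚ → IntegralRep 1}
  (hR : ∀ a b c : ℚ, 0 < a →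
    (R a b c).domain = {x | x 0 ∈ Set.Ioo (a:ℝ) b} ∧ (R a b c).integrand = fun x => (c:ℝ) / x 0)

include hR

/-! ## The carriers `Λ(N, c) = [(1, N), c/y]` modulo relations -/

/-- **The empty carrier**: `Λ(1, c) = 0` (null domain).
[cite: KontsevichZagier2001, §1.2 rule (1)] -/
theorem carrier_one (c : ℚ) : ((of (R 1 1 c) : FormalRep) : FormalRep ⧸ relations) = 0 :=
  (QuotientAddGroup.eq_zero_iff _).mpr
    (slab_empty_mem_relations (R 1 1 c) (hR 1 1 c one_pos).1 le_rfl)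

/-- **Additivity of the carriers in the numerator** (merging, rule 1b):
`Λ(N, c + c') = Λ(N, c) + Λ(N, c')`. [cite: KontsevichZagier2001, §1.2 rule (1)] -/
theorem carrier_add (N : ℚ) (c c' : ℚ) :
    ((of (R 1 N (c + c')) : FormalRep) : FormalRep ⧸ relations) =
      (of (R 1 N c) : FormalRep ⧸ relations) + (of (R 1 N c') : FormalRep ⧸ relations) :=
  mk_eq_add_of_sub_sub_mem
    (dlog_merge_mem_relations (R 1 N (c + c')) (R 1 N c) (R 1 N c') (hR 1 N _ one_pos).1
      (hR 1 N _ one_pos).1 (hR 1 N _ one_pos).1 (fun x _ => by rw [(hR 1 N _ one_pos).2])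
      (fun x _ => by rw [(hR 1 N _ one_pos).2]) (fun x _ => by rw [(hR 1 N _ one_pos).2]))

/-- **The zero carrier**: `Λ(N, 0) = 0`. [cite: KontsevichZagier2001, §1.2 rule (1)] -/
theorem carrier_zero (N : ℚ) : ((of (R 1 N 0) : FormalRep) : FormalRep ⧸ relations) = 0 :=
  (QuotientAddGroup.eq_zero_iff _).mpr
    (dlog_zero_mem_relations (R 1 N 0) fun x _ => by rw [(hR 1 N 0 one_pos).2])

/-- **Multiplicativity of the carriers**: `Λ(M N, c) = Λ(M, c) + Λ(N, c)` for `M, N ≥ 1` — split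
`(1, MN)` at `M` (rule 1a) and rescale `[(M, MN), c/y]` to `[(1, N), c/y]` by `y ↦ y/M` (rule 2).
[cite: KontsevichZagier2001, §1.2 rules (1), (2)] -/
theorem carrier_mul (c : ℚ) {M N : ℕ} (hM : M ≠ 0) (hN : N ≠ 0) :
    ((of (R 1 ((M * N : ℕ) : ℚ) c) : FormalRep) : FormalRep ⧸ relations) =
      (of (R 1 (M : ℚ) c) : FormalRep ⧸ relations) +
        (of (R 1 (N : ℚ) c) : FormalRep ⧸ relations) := by
  have hM1 : 1 ≤ M := Nat.one_le_iff_ne_zero.mpr hM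
  have hN1 : 1 ≤ N := Nat.one_le_iff_ne_zero.mpr hN
  have hMpos : (0:ℚ) < M := by exact_mod_cast hM1
  -- split `(1, MN)` at `M`
  have h1 : of (R 1 ((M * N : ℕ) : ℚ) c) - of (R 1 (M : ℚ) c) -
      of (R (M : ℚ) ((M * N : ℕ) : ℚ) c) ∈ relations := by
    refine split_mem_relations (R 1 ((M * N : ℕ) : ℚ) c) (R 1 (M : ℚ) c)
      (R (M : ℚ) ((M * N : ℕ) : ℚ) c) (hR 1 _ c one_pos).1 (hR 1 _ c one_pos).1
      (hR _ _ c hMpos).1 (by exact_mod_cast hM1) ?_ (fun x _ => ?_) (fun x _ => ?_)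
    · have : M ≤ M * N := Nat.le_mul_of_pos_right M hN1
      exact_mod_cast this
    · rw [(hR 1 _ c one_pos).2, (hR 1 _ c one_pos).2]
    · rw [(hR _ _ c hMpos).2, (hR 1 _ c one_pos).2]
  -- rescale `(1, N)` by `M`
  have h2 : of (R 1 (N : ℚ) c) - of (R ((M : ℚ) * 1) ((M : ℚ) * N) c) ∈ relations :=
    dlog_scale_mem_relations (R 1 (N : ℚ) c) (R ((M : ℚ) * 1) ((M : ℚ) * N) c)
      (hR 1 _ c one_pos).1 (hR _ _ c (by positivity)).1
      (fun x _ => by rw [(hR 1 _ c one_pos).2])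
      (fun x _ => by rw [(hR _ _ c (by positivity)).2]) one_pos hMpos
  rw [mul_one, ← Nat.cast_mul] at h2
  rw [mk_eq_add_of_sub_sub_mem h1, mk_eq_mk_of_sub_mem h2]

/-- **Unique factorisation of the carriers**: `Λ(N, c) = Σ_{p ∈ S} v_p(N) • Λ(p, c)` for `N ≠ 0`
and any finite set `S` containing the prime factors of `N`. [cite: KontsevichZagier2001, §1.2] -/
theorem carrier_eq_sum_factorization (c : ℚ) (S : Finset ℕ) :
    ∀ N : ℕ, N ≠ 0 → N.primeFactors ⊆ S →
      ((of (R 1 (N : ℚ) c) : FormalRep) : FormalRep ⧸ relations) =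
        ∑ p ∈ S, N.factorization p •
          ((of (R 1 (p : ℚ) c) : FormalRep) : FormalRep ⧸ relations) := by
  intro N
  induction N using induction_on_primes with
  | zero => intro h; exact absurd rfl h
  | one =>
    intro _ _
    rw [Nat.cast_one, carrier_one hR c, Nat.factorization_one]
    simp
  | prime_mul p a hp ih =>
    intro hpa hS
    have hp0 : p ≠ 0 := hp.ne_zero
    have ha0 : a ≠ 0 := fun h => hpa (by rw [h, mul_zero])
    rw [Nat.primeFactors_mul hp0 ha0, hp.primeFactors, Finset.union_subset_iff,
      Finset.singleton_subset_iff] at hS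
    rw [carrier_mul hR c hp0 ha0, ih ha0 hS.2, Nat.factorization_mul hp0 ha0,
      hp.factorization]
    simp only [Finsupp.coe_add, Pi.add_apply, add_smul, Finset.sum_add_distrib]
    congr 1
    rw [Finset.sum_eq_single_of_mem p hS.1 fun q _ hq => by
      rw [Finsupp.single_eq_of_ne hq, zero_smul]]
    rw [Finsupp.single_eq_same, one_smul]

/-! ## A dlog representation is a difference of two integer carriers -/

/-- **`[(a,b), c/y] = Λ(B, c) − Λ(A, c)` modulo relations**, where `b/a = B/A` in lowest terms
(`0 < a < b` rational): rescale by `A/a` (rule 2) onto `(A, B)` and split `(1, B)` at `A` (rule 1a).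
[cite: KontsevichZagier2001, §1.2 rules (1), (2)] -/
theorem exists_mk_of_eq_carrier_sub {a b c : ℚ} (ha : 0 < a) (hab : a < b) (L : IntegralRep 1)
    (hd : L.domain = {x | x 0 ∈ Set.Ioo (a:ℝ) b})
    (hi : EqOn L.integrand (fun x => (c:ℝ) / x 0) L.domain) :
    ∃ A B : ℕ, A ≠ 0 ∧ B ≠ 0 ∧ ((b:ℝ) / a = (B:ℝ) / A) ∧
      ((of L : FormalRep) : FormalRep ⧸ relations) =
        (of (R 1 (B : ℚ) c) : FormalRep ⧸ relations) -
          (of (R 1 (A : ℚ) c) : FormalRep ⧸ relations) := by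
  -- `b/a = B/A` in lowest terms
  set q : ℚ := b / a with hq
  have hq0 : 0 < q := div_pos (ha.trans hab) ha
  have hq1 : 1 < q := (one_lt_div ha).mpr hab
  have hnum : 0 < q.num := Rat.num_pos.mpr hq0
  set A : ℕ := q.den with hA
  set B : ℕ := q.num.toNat with hB
  have hApos : 0 < A := q.den_pos
  have hBq : ((B:ℕ):ℚ) = (q.num:ℚ) := by
    have : ((B:ℕ):ℤ) = q.num := Int.toNat_of_nonneg hnum.le
    exact_mod_cast this
  have hqBA : q = (B:ℚ) / (A:ℚ) := by rw [hBq]; exact (Rat.num_div_den q).symm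
  have hAq : (0:ℚ) < A := by exact_mod_cast hApos
  have hAB : A < B := by
    have : (1:ℚ) < (B:ℚ) / (A:ℚ) := hqBA ▸ hq1
    rw [one_lt_div hAq] at this
    exact_mod_cast this
  have hBpos : 0 < B := hApos.trans hAB
  refine ⟨A, B, hApos.ne', hBpos.ne', ?_, ?_⟩
  · have h := congrArg (fun r : ℚ => (r:ℝ)) hqBA
    simp only [hq, Rat.cast_div, Rat.cast_natCast] at h
    exact h
  -- rescale `L` by `s = A/a` onto `(A, B)`
  set s : ℚ := (A:ℚ) / a with hs
  have hs0 : 0 < s := div_pos hAq ha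
  have hsa : s * a = A := by rw [hs]; field_simp
  have hsb : s * b = B := by
    have hb : b = q * a := by rw [hq]; field_simp
    rw [hb, hqBA, hs]
    field_simp
  have h1 : of L - of (R (s * a) (s * b) c) ∈ relations :=
    dlog_scale_mem_relations L (R (s * a) (s * b) c) hd (hR _ _ c (by positivity)).1 hi
      (fun x _ => by rw [(hR _ _ c (by positivity)).2]) ha hs0
  rw [hsa, hsb] at h1
  -- split `(1, B)` at `A`
  have h2 :
      of (R 1 (B : ℚ) c) - of (R 1 (A : ℚ) c) - of (R (A : ℚ) (B : ℚ) c) ∈ relations := by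
    refine split_mem_relations (R 1 (B : ℚ) c) (R 1 (A : ℚ) c) (R (A : ℚ) (B : ℚ) c)
      (hR 1 _ c one_pos).1 (hR 1 _ c one_pos).1 (hR _ _ c hAq).1 (by exact_mod_cast hApos)
      (by exact_mod_cast hAB.le) (fun x _ => ?_) (fun x _ => ?_)
    · rw [(hR 1 _ c one_pos).2, (hR 1 _ c one_pos).2]
    · rw [(hR _ _ c hAq).2, (hR 1 _ c one_pos).2]
  rw [mk_eq_mk_of_sub_mem h1, eq_sub_iff_add_eq, add_comm, ← mk_eq_add_of_sub_sub_mem h2]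

end Carriers

/-! ## Logarithms of naturals over a fixed set of primes -/

/-- `log N = Σ_{p ∈ S} v_p(N) log p` for any finite `S ⊇ primeFactors N`. [folklore] -/
theorem log_nat_eq_sum_of_subset {N : ℕ} {S : Finset ℕ} (hS : N.primeFactors ⊆ S) :
    Real.log N = ∑ p ∈ S, (N.factorization p : ℝ) * Real.log p := by
  rw [Real.log_nat_eq_sum_factorization]
  exact Finsupp.sum_of_support_subset _ (by rwa [Nat.support_factorization]) _ fun p _ => by
    simp

/-! ## The theorem -/

/-- **Conjecture 1 in kernel form for the dlog family over `ℚ`** (registered sub-goal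
`dlog_sum_mem_relations` of the leaf `stub_boxRigidity`, crux `NormalFormPrinciple`): for dlog
representations `Lᵢ = [(aᵢ, bᵢ), cᵢ/y]` with rational data, `0 < aᵢ < bᵢ`, and integers `nᵢ`,
a vanishing value `eval (Σ nᵢ • [Lᵢ]) = 0` forces `Σ nᵢ • [Lᵢ] ∈ KZ.relations`. The class of the
combination is `Σ_{p ∈ S} Λ(p, C_p)` with the finite certificate
`C_p = Σᵢ nᵢ (v_p(Bᵢ) − v_p(Aᵢ)) cᵢ`, its value is `Σ_p C_p log p`, and `ℚ`-linear independence of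
the `log p` (unique factorisation + Hermite–Lindemann) gives `C = 0`.
[cite: KontsevichZagier2001, §1.2 Conjecture 1] -/
theorem dlog_sum_mem_relations {k : ℕ} (n : Fin k → ℤ) (a b c : Fin k → ℚ)
    (L : Fin k → IntegralRep 1) (ha : ∀ i, 0 < a i) (hab : ∀ i, a i < b i)
    (hd : ∀ i, (L i).domain = {x | x 0 ∈ Set.Ioo (a i : ℝ) (b i)})
    (hi : ∀ i, EqOn (L i).integrand (fun x => (c i : ℝ) / x 0) (L i).domain)
    (hv : eval (∑ i, n i • of (L i)) = 0) : ∑ i, n i • of (L i) ∈ relations := by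
  classical
  -- a choice of dlog representatives `R a b c = [(a,b), c/y]`
  obtain ⟨R, hR⟩ : ∃ R : ℚ → ℚ → ℚ → IntegralRep 1, ∀ a b c : ℚ, 0 < a →
      (R a b c).domain = {x | x 0 ∈ Set.Ioo (a:ℝ) b} ∧
        (R a b c).integrand = fun x => (c:ℝ) / x 0 := by
    refine ⟨fun a b c => if h : 0 < a then Classical.choose (exists_dlog a b c h)
      else Classical.choose (exists_dlog 1 b c one_pos), fun a b c h => ?_⟩
    simp only [dif_pos h]
    exact Classical.choose_spec (exists_dlog a b c h)
  -- the carriers `Λ(p, ·)` as additive maps `ℚ →+ Q`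
  let Λ : ℕ → ℚ →+ FormalRep ⧸ relations := fun p =>
    { toFun := fun c => ((of (R 1 (p : ℚ) c) : FormalRep) : FormalRep ⧸ relations)
      map_zero' := carrier_zero hR _
      map_add' := fun c c' => carrier_add hR _ c c' }
  have hΛ : ∀ (p : ℕ) (c : ℚ),
      Λ p c = ((of (R 1 (p : ℚ) c) : FormalRep) : FormalRep ⧸ relations) := fun _ _ => rfl
  -- integer carriers for each `Lᵢ`
  have hex : ∀ i, ∃ A B : ℕ, A ≠ 0 ∧ B ≠ 0 ∧ ((b i : ℝ) / a i = (B:ℝ) / A) ∧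
      ((of (L i) : FormalRep) : FormalRep ⧸ relations) =
        (of (R 1 (B : ℚ) (c i)) : FormalRep ⧸ relations) -
          (of (R 1 (A : ℚ) (c i)) : FormalRep ⧸ relations) :=
    fun i => exists_mk_of_eq_carrier_sub hR (ha i) (hab i) (L i) (hd i) (hi i)
  choose A B hA0 hB0 hBA hLi using hex
  -- the finite set of primes and the exponent matrix
  set S : Finset ℕ := Finset.univ.biUnion fun i => (A i).primeFactors ∪ (B i).primeFactors
    with hS
  have hSprime : ∀ p ∈ S, p.Prime := by
    intro p hp
    simp only [hS, Finset.mem_biUnion, Finset.mem_univ, true_and, Finset.mem_union] at hp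
    obtain ⟨i, hp | hp⟩ := hp <;> exact Nat.prime_of_mem_primeFactors hp
  have hAS : ∀ i, (A i).primeFactors ⊆ S := fun i p hp =>
    Finset.mem_biUnion.mpr ⟨i, Finset.mem_univ _, Finset.mem_union_left _ hp⟩
  have hBS : ∀ i, (B i).primeFactors ⊆ S := fun i p hp =>
    Finset.mem_biUnion.mpr ⟨i, Finset.mem_univ _, Finset.mem_union_right _ hp⟩
  set d : Fin k → ℕ → ℤ := fun i p => ((B i).factorization p : ℤ) - ((A i).factorization p : ℤ)
    with hdid
  -- the certificate
  set C : ℕ → ℚ := fun p => ∑ i, ((n i * d i p : ℤ) : ℚ) * c i with hC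
  -- (1) the class of the combination is `Σ_{p ∈ S} Λ(p, C_p)`
  have hclass :
      ((∑ i, n i • of (L i) : FormalRep) : FormalRep ⧸ relations) = ∑ p ∈ S, Λ p (C p) := by
    have hcarrier : ∀ i, ((of (L i) : FormalRep) : FormalRep ⧸ relations) =
        ∑ p ∈ S, d i p • Λ p (c i) := by
      intro i
      rw [hLi i, ← hΛ, ← hΛ]
      rw [hΛ, carrier_eq_sum_factorization hR (c i) S (B i) (hB0 i) (hBS i),
        hΛ, carrier_eq_sum_factorization hR (c i) S (A i) (hA0 i) (hAS i),
        ← Finset.sum_sub_distrib]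
      refine Finset.sum_congr rfl fun p _ => ?_
      rw [hdid, sub_smul, ← hΛ, natCast_zsmul, natCast_zsmul]
    calc ((∑ i, n i • of (L i) : FormalRep) : FormalRep ⧸ relations)
        = ∑ i, n i • ((of (L i) : FormalRep) : FormalRep ⧸ relations) := by
          simp only [QuotientAddGroup.mk_sum, QuotientAddGroup.mk_zsmul]
      _ = ∑ i, ∑ p ∈ S, Λ p ((n i * d i p : ℤ) • c i) := by
          refine Finset.sum_congr rfl fun i _ => ?_
          rw [hcarrier i, Finset.smul_sum]
          refine Finset.sum_congr rfl fun p _ => ?_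
          rw [map_zsmul, smul_smul]
      _ = ∑ p ∈ S, Λ p (C p) := by
          rw [Finset.sum_comm]
          refine Finset.sum_congr rfl fun p _ => ?_
          rw [hC, map_sum]
          simp only [zsmul_eq_mul]
  -- (2) the value of the combination is `Σ_{p ∈ S} C_p log p`
  have hvalue : ∀ i, (L i).value = (c i : ℝ) * ∑ p ∈ S, (d i p : ℝ) * Real.log p := by
    intro i
    rw [value_dlog (L i) (hd i) (hi i) (ha i) (hab i).le, hBA i,
      Real.log_div (by exact_mod_cast hB0 i) (by exact_mod_cast hA0 i),
      log_nat_eq_sum_of_subset (hBS i), log_nat_eq_sum_of_subset (hAS i),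
      ← Finset.sum_sub_distrib]
    congr 1
    refine Finset.sum_congr rfl fun p _ => ?_
    rw [hdid]
    push_cast
    ring
  have hval : ((0:ℚ):ℝ) + ∑ p ∈ S, (C p : ℝ) * Real.log p = 0 := by
    rw [Rat.cast_zero, zero_add, ← hv, map_sum]
    simp only [map_zsmul, eval_of, zsmul_eq_mul, hvalue, hC]
    push_cast
    simp only [Finset.mul_sum, Finset.sum_mul]
    rw [Finset.sum_comm]
    refine Finset.sum_congr rfl fun i _ => Finset.sum_congr rfl fun p _ => ?_
    ring
  -- (3) the certificate vanishes, hence so does the class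
  have hC0 := (eq_zero_of_rat_add_sum_mul_log_prime_eq_zero hSprime 0 C hval).2
  rw [← QuotientAddGroup.eq_zero_iff, hclass]
  exact Finset.sum_eq_zero fun p hp => by rw [hC0 p hp, map_zero]

end K8

end Dlog

end Summit.KontsevichZagierPeriods.HurwitzMicroSectors.NormalFormPrinciple.PiBox
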